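import Summits.ResolutionOfSingularities.ResolutionOfSingularities.Theorems.EquisingularLiftEquisingularLiftNatKeyFormModel
import Summits.ResolutionOfSingularities.ResolutionOfSingularities.Theorems.EquisingularLiftEquisingularLiftNatEquinodalHyperplaneAlg
import HarnessLib

/-!
# [OURS · L1 W4.5(b) · EL♮(3) · door ν4, brick N-0 (JINIT at `RD := RPlus`), piece (N0-d)] THE NOSE MODEL `𝓦₀ = (λ̃, Ĝ)~ ⊂ ℙⁿ_O`:
# `𝓛₀ ≤ 𝓦₀` · `O`-FLAT · REDUCED TRACE `𝓘⟨Z⟩` — three `NoseDatum` conjuncts of Level B, from ✓ SatLift / ✓ CILift / ✓ KeyForm / ✓ HyperplaneAlg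

res-L1-w45b-nose-w1 g4 (WIDTH seat D-0157 DOOR 1; N-0 owner).  DEF-FREE; no `sorry`; standard axioms.  `--supports stmt-ResolutionOfSingularities-20148
--as helper`, counted 0.

OBJECTS (Level B of the N-0 conditional assembly ✓ `jinit_rPlus₀_of_noseDatum₂`): with the lifted hyperplane data of ✓ `HyperplaneLift.exists_hyperplane_lift`
(`L̃ = Σ c̃_a x_a`, substitution `ψ̃ = (x ↦ B̃·y)` with section `σ̃`, kernel `(L̃)`) and the (S1) lift `G̃ ∈ O[y₀,y₁,y₂]` of ✓ `exists_equinodal_lift_of_cert_of_surjective`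
(`θ G̃ = g|_Π ≠ 0`), the nose model on `ℙⁿ_O` is the complete-intersection ideal sheaf `𝓦₀ := (F)~`, `F = ![L̃, σ̃ G̃]` (CILift currency
`projIdealSheaf ⟨span (range F), _⟩`), and the host letter is `𝓛₀ := (![L̃])~`.  THIS FILE:
* `projIdealSheaf_mono` (chartwise, `Scheme.IdealSheafData.le_of_iSup_eq_top`) ⇒ ★ `letter_le_nose : 𝓛₀ ≤ 𝓦₀`;
* ★ `flat_nose`: `V(𝓦₀) → Spec O` FLAT — `(L̃, σ̃ G̃)` is `ϖ`-saturated (✓ `HyperplaneAlg.saturated_pair_of_saturated` ∘ ✓ `KeyForm.mem_span_singleton_of_C_mul_mem`,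
  `θ G̃ ≠ 0`) ⇒ ✓ `SatLift.flat_subschemeι_projIdealSheaf_of_saturated`;
* ★ `comap_nose_eq_vanishingIdeal`: the TRACE `𝓦₀ · 𝒪_{ℙⁿ_k} = 𝓘⟨Z⟩` for `Z = V₊(f)` whenever the reductions `f = φ F` span a RADICAL ideal
  (✓ `CILift.comap_projIdealSheaf_span` ∘ ✓ `SatLift.projIdealSheaf_eq_vanishingIdeal`), and ★ `isRadical_span_pair` / `setOf_pair_eq` — the algebra
  that feeds it for `f = ![λ, σ g|_Π]`: radical by ✓ `HyperplaneAlg.isRadical_pair_of_isRadical` (squarefree `g|_Π`), and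
  `{λ ∈ 𝔭 ∧ σ(g|_Π) ∈ 𝔭} = {ℓ ∈ 𝔭 ∧ g ∈ 𝔭}` (✓ `dvd_sub_section`, `V₊(ℓ) = V₊(λ)` from ✓ `HostNormalForm`).
EL♮(3) is NOT proved; resolution of singularities in positive characteristic is NOT proved.
-/

set_option linter.dupNamespace false -- mandated namespace `Summit.<Summit>.<Problem>` of this single-conjunct summit
set_option linter.overlappingInstances false -- signatures carry `[IsDomain O] [IsDiscreteValuationRing O]`

noncomputable section

open CategoryTheory AlgebraicGeometry TopologicalSpace IsLocalRing
open MvPolynomial HomogeneousLocalization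
open Literature.AlgebraicGeometry.Resolution Literature.RingTheory.GradedAlgebra

namespace Summit.ResolutionOfSingularities.ResolutionOfSingularities.Cruxes.EquisingularLiftNat.Sections.Equinodal.NoseModel

/-! ## §1 Monotonicity of `projIdealSheaf` on `ℙⁿ`; the letter lies in the nose -/

/-- `I ≤ J ⇒ Ĩ ≤ J̃` on `ℙⁿ_R` (chartwise on the `D₊(x_i)`). [cite: Hartshorne1977, II Prop. 5.9] -/
theorem projIdealSheaf_mono (R : Type) [CommRing R] (n : ℕ) :
    letI := MvPolynomial.gradedAlgebra (σ := Fin (n + 1)) (R := R)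
    ∀ {I J : HomogeneousIdeal (homogeneousSubmodule (Fin (n + 1)) R)}, I ≤ J →
      projIdealSheaf (homogeneousSubmodule (Fin (n + 1)) R) I ≤ projIdealSheaf (homogeneousSubmodule (Fin (n + 1)) R) J := by
  letI := MvPolynomial.gradedAlgebra (σ := Fin (n + 1)) (R := R)
  intro I J hIJ
  refine Scheme.IdealSheafData.le_of_iSup_eq_top
    (fun i : Fin (n + 1) => (⟨Proj.basicOpen (homogeneousSubmodule (Fin (n + 1)) R) (X i),
      Proj.isAffineOpen_basicOpen (homogeneousSubmodule (Fin (n + 1)) R) (X i) (CILift.X_mem_one' i) one_pos⟩ :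
        (Proj (homogeneousSubmodule (Fin (n + 1)) R)).affineOpens)) (SatLift.iSup_chart_eq_top R n) fun i => ?_
  rw [SatLift.ideal_chart, SatLift.ideal_chart]
  exact Ideal.map_mono (awayIdeal_mono _ _ hIJ)

/-- `range ![a] ⊆ range ![a, b]`, as spans. [folklore] -/
theorem span_range_single_le {A : Type*} [CommRing A] (a b : A) :
    Ideal.span (Set.range ![a]) ≤ Ideal.span (Set.range ![a, b]) := by
  refine Ideal.span_mono ?_
  rintro _ ⟨i, rfl⟩
  fin_cases i
  exact ⟨0, rfl⟩

/-- `span (range ![a, b]) = span {a, b}`. [folklore] -/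
theorem span_range_pair {A : Type*} [CommRing A] (a b : A) : Ideal.span (Set.range ![a, b]) = Ideal.span {a, b} := by
  rw [Matrix.range_cons, Matrix.range_cons, Matrix.range_empty, Set.union_empty, Set.singleton_union]

/-- ★ **THE LETTER LIES IN THE NOSE: `(L̃)~ ≤ (L̃, Ĝ)~`.** [OURS · `NoseDatum` conjunct `𝓛 ≤ 𝓦`] -/
theorem letter_le_nose (R : Type) [CommRing R] {n : ℕ} (Lt Gh : MvPolynomial (Fin (n + 1)) R) (e : ℕ)
    (hL : ∀ l, (![Lt] : Fin 1 → _) l ∈ homogeneousSubmodule (Fin (n + 1)) R ((![1] : Fin 1 → ℕ) l))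
    (hF : ∀ l, (![Lt, Gh] : Fin 2 → _) l ∈ homogeneousSubmodule (Fin (n + 1)) R ((![1, e] : Fin 2 → ℕ) l)) :
    letI := MvPolynomial.gradedAlgebra (σ := Fin (n + 1)) (R := R)
    projIdealSheaf (homogeneousSubmodule (Fin (n + 1)) R) ⟨Ideal.span (Set.range ![Lt]), isHomogeneous_span_of_forall_mem _ _ _ hL⟩ ≤
      projIdealSheaf (homogeneousSubmodule (Fin (n + 1)) R) ⟨Ideal.span (Set.range ![Lt, Gh]), isHomogeneous_span_of_forall_mem _ _ _ hF⟩ :=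
  projIdealSheaf_mono R n (span_range_single_le Lt Gh)

/-! ## §2 Flatness over `O` -/

section Flat

variable (O : Type) [CommRing O] [IsDomain O] [IsDiscreteValuationRing O] {k : Type} [Field k] (θ : O →+* k)
  (hθ : Function.Surjective θ) {n m : ℕ}

include hθ in
/-- ★ **`V((L̃, σ̃ G̃)~) → Spec O` IS FLAT.**  `ψ̃ : O[x₀..xₙ] → O[y₀..y_m]` an `O`-algebra map with set-theoretic section `σ̃` and kernel `(L̃)`
(`ψ̃ L̃ = 0`, `ψ̃ ∘ σ̃ = id`, `ψ̃ f = 0 ⇒ L̃ ∣ f`), `G̃ ∈ O[y]` with NON-ZERO reduction `θ G̃`: then `(L̃, σ̃ G̃)` is `ϖ`-saturated (transfer of the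
saturation of `(G̃)`), so the complete-intersection model is `O`-flat. [cite: Hartshorne1977, III Prop. 9.7] -/
theorem flat_nose (ψ : MvPolynomial (Fin (n + 1)) O →ₐ[O] MvPolynomial (Fin (m + 1)) O)
    (σf : MvPolynomial (Fin (m + 1)) O → MvPolynomial (Fin (n + 1)) O) (Lt : MvPolynomial (Fin (n + 1)) O)
    (hψL : ψ Lt = 0) (hψσ : ∀ G, ψ (σf G) = G) (hker : ∀ f, ψ f = 0 → Lt ∣ f)
    (Gt : MvPolynomial (Fin (m + 1)) O) (hGt0 : MvPolynomial.map θ Gt ≠ 0) (e : ℕ)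
    (hF : ∀ l, (![Lt, σf Gt] : Fin 2 → _) l ∈ homogeneousSubmodule (Fin (n + 1)) O ((![1, e] : Fin 2 → ℕ) l)) :
    letI := MvPolynomial.gradedAlgebra (σ := Fin (n + 1)) (R := O)
    Flat ((projIdealSheaf (homogeneousSubmodule (Fin (n + 1)) O)
        ⟨Ideal.span (Set.range ![Lt, σf Gt]), isHomogeneous_span_of_forall_mem _ _ _ hF⟩).subschemeι ≫
      (Proj.toSpecZero (homogeneousSubmodule (Fin (n + 1)) O) ≫
        Spec.map (CommRingCat.ofHom (algebraMap O ((homogeneousSubmodule (Fin (n + 1)) O) 0))))) := by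
  letI := MvPolynomial.gradedAlgebra (σ := Fin (n + 1)) (R := O)
  obtain ⟨ϖ, hϖ⟩ := IsDiscreteValuationRing.exists_irreducible O
  refine SatLift.flat_subschemeι_projIdealSheaf_of_saturated O ϖ hϖ ![Lt, σf Gt] ![1, e] hF ?_
  intro y hy
  rw [span_range_pair] at hy ⊢
  have hsatG : ∀ y' : MvPolynomial (Fin (m + 1)) O, ψ.toRingHom (C ϖ) * y' ∈ Ideal.span {Gt} → y' ∈ Ideal.span {Gt} := by
    intro y' hy'
    have hC : ψ.toRingHom (C ϖ) = C ϖ := by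
      change ψ (C ϖ) = C ϖ
      rw [← MvPolynomial.algebraMap_eq, AlgHom.commutes, MvPolynomial.algebraMap_eq]
    rw [hC] at hy'
    exact KeyForm.mem_span_singleton_of_C_mul_mem O θ hθ ϖ hϖ Gt hGt0 y' hy'
  exact HyperplaneAlg.saturated_pair_of_saturated ψ.toRingHom σf Lt hψL hψσ hker Gt (C ϖ) hsatG y hy

end Flat

/-! ## §3 The trace on the special fibre -/

section Trace

/-- ★ **THE REDUCED TRACE OF A COMPLETE-INTERSECTION MODEL**: if the reductions `f = φ F` span a RADICAL ideal with zero set `Z`, then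
`(F)~ · 𝒪_{ℙⁿ_k} = 𝓘⟨Z⟩` (✓ `CILift.comap_projIdealSheaf_span` + ✓ `SatLift.projIdealSheaf_eq_vanishingIdeal`). [cite: Hartshorne1977, II Cor. 5.16] -/
theorem comap_eq_vanishingIdeal_of_isRadical {O k : Type} [CommRing O] [Field k] {n c : ℕ} :
    letI := MvPolynomial.gradedAlgebra (σ := Fin (n + 1)) (R := O)
    letI := MvPolynomial.gradedAlgebra (σ := Fin (n + 1)) (R := k)
    ∀ (φ : (homogeneousSubmodule (Fin (n + 1)) O) →+*ᵍ (homogeneousSubmodule (Fin (n + 1)) k))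
      (hφ' : HomogeneousIdeal.irrelevant (homogeneousSubmodule (Fin (n + 1)) k) ≤
        (HomogeneousIdeal.irrelevant (homogeneousSubmodule (Fin (n + 1)) O)).map φ)
      (_hφX : ∀ i : Fin (n + 1), φ (X i) = X i)
      (F : Fin c → MvPolynomial (Fin (n + 1)) O) (f : Fin c → MvPolynomial (Fin (n + 1)) k) (d : Fin c → ℕ)
      (hF : ∀ l, F l ∈ homogeneousSubmodule (Fin (n + 1)) O (d l)) (hf : ∀ l, f l ∈ homogeneousSubmodule (Fin (n + 1)) k (d l))
      (_hφF : ∀ l, φ (F l) = f l) (_hrad : (Ideal.span (Set.range f)).IsRadical)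
      (Z : Set (Proj (homogeneousSubmodule (Fin (n + 1)) k))) (hZ : IsClosed Z) (_hZf : Z = {y | ∀ l, f l ∈ y.asHomogeneousIdeal}),
    (projIdealSheaf (homogeneousSubmodule (Fin (n + 1)) O)
        ⟨Ideal.span (Set.range F), isHomogeneous_span_of_forall_mem _ F d hF⟩).comap (Proj.map φ hφ') =
      Scheme.IdealSheafData.vanishingIdeal ⟨Z, hZ⟩ := by
  letI := MvPolynomial.gradedAlgebra (σ := Fin (n + 1)) (R := O)
  letI := MvPolynomial.gradedAlgebra (σ := Fin (n + 1)) (R := k)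
  intro φ hφ' hφX F f d hF hf hφF hrad Z hZ hZf
  rw [CILift.comap_projIdealSheaf_span φ hφ' hφX F f d hF hf hφF]
  refine SatLift.projIdealSheaf_eq_vanishingIdeal _ hrad Z hZ ?_
  rw [hZf]
  ext y
  simp only [Set.mem_setOf_eq]
  change _ ↔ Ideal.span (Set.range f) ≤ _
  rw [Ideal.span_le, Set.range_subset_iff]
  rfl

end Trace

/-! ## §4 The algebra feeding §3 for `f = ![λ, σ(g|_Π)]` -/

section PairAlgebra

variable {k : Type} [Field k] {n m : ℕ} (ψ : MvPolynomial (Fin (n + 1)) k →+* MvPolynomial (Fin (m + 1)) k)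
  (σf : MvPolynomial (Fin (m + 1)) k → MvPolynomial (Fin (n + 1)) k) (L : MvPolynomial (Fin (n + 1)) k)
  (hψL : ψ L = 0) (hψσ : ∀ G, ψ (σf G) = G) (hker : ∀ f, ψ f = 0 → L ∣ f)

include hψL hψσ hker in
/-- `(λ, σ h)` spans a RADICAL ideal when `h` is squarefree. [folklore] -/
theorem isRadical_span_range_pair (h : MvPolynomial (Fin (m + 1)) k) (hsq : Squarefree h) :
    (Ideal.span (Set.range ![L, σf h])).IsRadical := by
  rw [span_range_pair]
  exact HyperplaneAlg.isRadical_pair_of_isRadical ψ σf L hψL hψσ hker h (HyperplaneAlg.isRadical_span_singleton_of_squarefree h hsq)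

include hψσ hker in
/-- The zero set of `(λ, σ (ψ g))` is `V₊(ℓ) ∩ V₊(g)` once `V₊(ℓ) = V₊(λ)` (`λ ∣ g − σ ψ g`). [folklore] -/
theorem setOf_pair_eq (ℓ g : MvPolynomial (Fin (n + 1)) k) :
    letI := MvPolynomial.gradedAlgebra (σ := Fin (n + 1)) (R := k)
    {y : Proj (homogeneousSubmodule (Fin (n + 1)) k) | ℓ ∈ y.asHomogeneousIdeal} =
      {y : Proj (homogeneousSubmodule (Fin (n + 1)) k) | L ∈ y.asHomogeneousIdeal} →
    {y : Proj (homogeneousSubmodule (Fin (n + 1)) k) | ℓ ∈ y.asHomogeneousIdeal ∧ g ∈ y.asHomogeneousIdeal} =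
      {y : Proj (homogeneousSubmodule (Fin (n + 1)) k) | ∀ l, (![L, σf (ψ g)] : Fin 2 → _) l ∈ y.asHomogeneousIdeal} := by
  letI := MvPolynomial.gradedAlgebra (σ := Fin (n + 1)) (R := k)
  intro hV
  have hV' : ∀ y : Proj (homogeneousSubmodule (Fin (n + 1)) k), ℓ ∈ y.asHomogeneousIdeal ↔ L ∈ y.asHomogeneousIdeal :=
    fun y => Set.ext_iff.mp hV y
  obtain ⟨q, hq⟩ := HyperplaneAlg.dvd_sub_section ψ σf L hψσ hker g
  ext y
  simp only [Set.mem_setOf_eq, Fin.forall_fin_two, Matrix.cons_val_zero, Matrix.cons_val_one]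
  rw [hV' y]
  refine and_congr_right fun hLy => ?_
  have hLy' : L * q ∈ (ProjectiveSpectrum.asHomogeneousIdeal y).toIdeal := Ideal.mul_mem_right _ _ hLy
  have e₁ : σf (ψ g) = g - L * q := by rw [← hq]; ring
  have e₂ : g = σf (ψ g) + L * q := by rw [← hq]; ring
  constructor
  · intro hg
    have h' : g - L * q ∈ (ProjectiveSpectrum.asHomogeneousIdeal y).toIdeal := Ideal.sub_mem _ hg hLy'
    rw [← e₁] at h'
    exact h'
  · intro hσ
    have h' : σf (ψ g) + L * q ∈ (ProjectiveSpectrum.asHomogeneousIdeal y).toIdeal := Ideal.add_mem _ hσ hLy'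
    rw [← e₂] at h'
    exact h'

end PairAlgebra

end Summit.ResolutionOfSingularities.ResolutionOfSingularities.Cruxes.EquisingularLiftNat.Sections.Equinodal.NoseModel

end
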